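import Literature.NumberTheory.ComplexMultiplication.ReflexNormIdelesLocalIntegrality   -- ★ (α)(β)(γ): `reflexNormLocal` units∕congruence, `reflexNormFiniteIdele_mem_congruenceUnits`
import Literature.NumberTheory.NumberFields.CyclotomicCharacterIdele                   -- ★ `count_coe_eq_modulusExp` (Mathlib `count` = the tree՚s `modulusExp`)
import HarnessLib

/-!
# The reflex norm `g_f` preserves the congruence `u ≡ 1 mod (M)` READ AT THE PRIMES OF `(M)` ONLY
# ([Shimura 1998] §18.6 proof p. 128; [Neukirch 1999] VI §1 (1.7)–(1.9))

Topic `NumberTheory/ComplexMultiplication`; namespace `Literature.NumberTheory.ComplexMultiplication`.  THEOREMS ONLY (no definition, no named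
fact, no instance, no notation, no `sorry`; net debt 0).  Cell `hodgecm-mathlib`, FLOOR 0, P6 «MOD programme» (crux hLiu418 = stmt-HodgeConjecture-24832,
`--supports`), X-LEAF sheet line, (S8) closer `stub_ESHEET`, organ (S6) «TWIST DATA» (socket `stub_TWIST`, «L4» LA4-plan (g2) DEAL #30 → LA4-p05 (g4)),
glue (B2) of the census: the level-adapted Artin correspondents of ★ `ArtinCorrespondentPrimeRepresentative` (LA7-p02 (g3)) come with the congruence
`|u_v| = 1 ∧ |u_v − 1| ≤ q_v^{−n_v}` ONLY AT THE PRIMES `v` OF THE MODULUS (their ideal `(u) = 𝔟` is not trivial, so `u ∉ I^{(M)}`), and the junction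
`IsSheetTwistOf` of the closer wants the same shape for `t(u) = g_f(u)` at the primes of `(N)` in `F`; the tree՚s ★ `reflexNormFiniteIdele_mem_congruenceUnits`
(Shimura՚s (α)(β): `g_f(I_k^{(M)}) ⊆ I_K^{(M)}`) asks for Neukirch՚s FULL congruence subgroup.  Since `g_f` is computed one rational prime at a time
(★ `reflexNormFiniteAdele_apply_extension`: `(g_f u)_w = N_p((u_v)_{v ∣ p})_w` for `w ∣ p`), and every `v ∣ p` divides `(M)` as soon as `p ∣ M`, the
local hypothesis at the primes of `(M)` suffices — this file records that refinement, in the `modulusExp` spelling of the sheet line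
(★ `HeckeCharacterOfRayClass.modulusExp`, ★ `count_coe_eq_modulusExp`).

* `natCast_mem_asIdeal_of_under_eq` — primes over the same rational prime as a prime of `(M)` are primes of `(M)`.
* **`reflexNormFiniteIdele_congr_at_primes_natCast`** — `(∀ v ⊇ (M), |u_v| = 1 ∧ |u_v − 1| ≤ exp(−n_v(M))) ⇒ (∀ w ⊇ (M), |g_f(u)_w| = 1 ∧ |g_f(u)_w − 1| ≤ exp(−n_w(M)))`.
* `reflexNormFiniteIdele_congr_at_primes_natCast_inv` — the same for `g_f(u)⁻¹` (the closer՚s `z = t⁻¹` spelling, whichever sign the junction keeps).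

## References
* [Shimura1998] G. Shimura, *Abelian Varieties with Complex Multiplication and Modular Functions* (1998), §18.5 p. 123, §18.6 proof p. 128.
* [NeukirchANT1999] J. Neukirch, *Algebraic Number Theory* (1999), Ch. VI §1 Def. (1.7) and Prop. (1.9) pp. 363–365.
* [MilneCM2006] J. S. Milne, *Complex Multiplication* (2006), Ch. I §1 Rem. 1.25.
HC_CM is proved only modulo the printed citations (2 remaining named inputs hLiu418 24832, h413 24833) until rung 0 closes — count-neutral.
-/

set_option autoImplicit false

noncomputable section

open Module
open scoped TensorProduct NumberField nonZeroDivisors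

namespace Literature.NumberTheory.ComplexMultiplication

open Literature.AlgebraicGeometry.Motives (CMType)
open Literature.NumberTheory.NumberFields
open Literature.NumberTheory.GaloisRepresentations (modulusExp)
open Literature.NumberTheory.Automorphic.FiniteAdeleRing (unitOrd unitOrd_eq_zero_iff valued_apply_ne_zero)
open NumberField IsDedekindDomain IsDedekindDomain.HeightOneSpectrum WithZero

section CongruenceAtPrimes

variable (K : Type) [Field K] [NumberField K] (Φ : CMType K) (k : IntermediateField ℚ ℂ) [NumberField k]

/-- **Primes over a prime of `(M)` are primes of `(M)`**: if `(M) ≤ 𝔭_w` in `K` and a prime `v` of `k` lies over the same rational prime as `w`, then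
`(M) ≤ 𝔭_v` — both say `p ∣ M` for the common rational prime `p`. [cite: NeukirchANT1999, Ch. I §8 (primes above p)] -/
theorem natCast_mem_asIdeal_of_under_eq {F F' : Type} [Field F] [NumberField F] [Field F'] [NumberField F'] (M : ℕ)
    {w : HeightOneSpectrum (𝓞 F)} (hw : Ideal.span {(M : 𝓞 F)} ≤ w.asIdeal) {v : HeightOneSpectrum (𝓞 F')}
    (hv : v.under (𝓞 ℚ) = w.under (𝓞 ℚ)) : Ideal.span {(M : 𝓞 F')} ≤ v.asIdeal := by
  rw [Ideal.span_singleton_le_iff_mem] at hw ⊢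
  have hMp : (M : 𝓞 ℚ) ∈ (w.under (𝓞 ℚ)).asIdeal := by
    rw [under_asIdeal, Ideal.under_def, Ideal.mem_comap, map_natCast]
    exact hw
  rw [← hv, under_asIdeal, Ideal.under_def, Ideal.mem_comap, map_natCast] at hMp
  exact hMp

/-- **`g_f` PRESERVES THE CONGRUENCE `≡ 1 mod (M)` READ AT THE PRIMES OF `(M)`** (Shimura՚s (α)(β) of §18.6, one rational prime at a time): if
`|u_v|_v = 1` and `|u_v − 1|_v ≤ exp(−n_v(M))` at every prime `v ⊇ (M)` of `k` (no condition elsewhere — `u` may carry any ideal prime to `M`), then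
`|g_f(u)_w|_w = 1` and `|g_f(u)_w − 1|_w ≤ exp(−n_w(M))` at every prime `w ⊇ (M)` of `K`.  For `w ∣ p ∣ M`: `(g_f u)_w = N_p((u_v)_{v∣p})_w`
(★ `reflexNormFiniteAdele_apply_extension`), every `v ∣ p` is a prime of `(M)`, `u_p = 1 + M·t′` with `t′` integral, `N_p(1 + M t′) = 1 + M·y` with `y`
integral (★ `exists_reflexNormLocal_one_add_nsmul`) and `N_p` sends units to units (★ `valued_reflexNormLocal_eq_one`).
[cite: Shimura1998, §18.6 proof p. 128 («e_v ∈ 𝔯_v^× and e_v − 1 ∈ M𝔯_v … g(e)_p ∈ 𝔬_p^×»), §18.5 p. 123] [cite: NeukirchANT1999, Ch. VI §1 Def. (1.7) p. 363] -/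
theorem reflexNormFiniteIdele_congr_at_primes_natCast {M : ℕ} (hM : M ≠ 0) {u : (FiniteAdeleRing (𝓞 k) k)ˣ}
    (hu : ∀ v : HeightOneSpectrum (𝓞 k), Ideal.span {(M : 𝓞 k)} ≤ v.asIdeal →
      Valued.v ((u : FiniteAdeleRing (𝓞 k) k) v) = 1 ∧
      Valued.v ((u : FiniteAdeleRing (𝓞 k) k) v - 1) ≤ exp (-(modulusExp (Ideal.span {(M : 𝓞 k)}) v : ℤ))) :
    ∀ w : HeightOneSpectrum (𝓞 K), Ideal.span {(M : 𝓞 K)} ≤ w.asIdeal →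
      Valued.v ((reflexNormFiniteIdele K Φ k u : FiniteAdeleRing (𝓞 K) K) w) = 1 ∧
      Valued.v ((reflexNormFiniteIdele K Φ k u : FiniteAdeleRing (𝓞 K) K) w - 1) ≤
        exp (-(modulusExp (Ideal.span {(M : 𝓞 K)}) w : ℤ)) := by
  intro w hw
  have hMk : (Ideal.span {(M : 𝓞 k)} : Ideal (𝓞 k)) ≠ ⊥ := by
    rw [Ne, Ideal.span_singleton_eq_bot]; exact_mod_cast hM
  have hMK : (Ideal.span {(M : 𝓞 K)} : Ideal (𝓞 K)) ≠ ⊥ := by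
    rw [Ne, Ideal.span_singleton_eq_bot]; exact_mod_cast hM
  let p : HeightOneSpectrum (𝓞 ℚ) := w.under (𝓞 ℚ)
  let w' : p.Extension (𝓞 K) := ⟨w, rfl⟩
  -- every `v ∣ p` in `k` is a prime of `(M)`, so `hu` is available on the whole fibre over `p`
  have huv : ∀ v : p.Extension (𝓞 k),
      Valued.v ((u : FiniteAdeleRing (𝓞 k) k) v.1) = 1 ∧
      Valued.v ((u : FiniteAdeleRing (𝓞 k) k) v.1 - 1) ≤
        exp (-(FractionalIdeal.count k v.1 ((Ideal.span {(M : 𝓞 k)} : Ideal (𝓞 k)) : FractionalIdeal (𝓞 k)⁰ k))) := by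
    intro v
    have hv := hu v.1 (natCast_mem_asIdeal_of_under_eq M hw v.2)
    rw [count_coe_eq_modulusExp hMk v.1]
    exact hv
  -- the `p`-component of `u` and its shape `1 + M • t'`
  let t : Π v : p.Extension (𝓞 k), v.1.adicCompletion k := fun v => (u : FiniteAdeleRing (𝓞 k) k) v.1
  let t' : Π v : p.Extension (𝓞 k), v.1.adicCompletion k :=
    fun v => ((u : FiniteAdeleRing (𝓞 k) k) v.1 - 1) / algebraMap k (v.1.adicCompletion k) (M : k)
  have hMv : ∀ v : p.Extension (𝓞 k), algebraMap k (v.1.adicCompletion k) (M : k) ≠ 0 := fun v =>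
    (map_ne_zero (algebraMap k (v.1.adicCompletion k))).2 (Nat.cast_ne_zero.2 hM)
  have ht1 : ∀ v, Valued.v (t v) = 1 := fun v => (huv v).1
  have ht' : ∀ v, t' v ∈ v.1.adicCompletionIntegers k := fun v => by
    rw [mem_adicCompletionIntegers, map_div₀, valued_natCast_eq_exp_neg_count k v.1 M hM]
    exact div_le_one_of_le₀ (huv v).2 zero_le
  have htt' : t = 1 + M • t' := by
    funext v
    rw [Pi.add_apply, Pi.smul_apply, Pi.one_apply, nsmul_eq_mul, ← map_natCast (algebraMap k (v.1.adicCompletion k)) M,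
      mul_div_cancel₀ _ (hMv v), add_sub_cancel]
  obtain ⟨y, hy, hNy⟩ := exists_reflexNormLocal_one_add_nsmul K Φ k p M t' ht'
  have hgw : (reflexNormFiniteIdele K Φ k u : FiniteAdeleRing (𝓞 K) K) w = 1 + M • y w' := by
    change (reflexNormFiniteIdele K Φ k u : FiniteAdeleRing (𝓞 K) K) w'.1 = _
    rw [coe_reflexNormFiniteIdele, reflexNormFiniteAdele_apply_extension K Φ k p _ w', show
      (fun v : p.Extension (𝓞 k) => (u : FiniteAdeleRing (𝓞 k) k) v.1) = t from rfl, htt', hNy]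
    rfl
  refine ⟨?_, ?_⟩
  · -- a unit at `w`, by (β)
    change Valued.v ((reflexNormFiniteIdele K Φ k u : FiniteAdeleRing (𝓞 K) K) w'.1) = 1
    rw [coe_reflexNormFiniteIdele, reflexNormFiniteAdele_apply_extension K Φ k p _ w']
    exact valued_reflexNormLocal_eq_one K Φ k p t ht1 w'
  · -- the congruence at `w`, by (α)
    rw [← count_coe_eq_modulusExp hMK w, hgw, add_sub_cancel_left, nsmul_eq_mul,
      ← map_natCast (algebraMap K (w.adicCompletion K)) M, map_mul, valued_natCast_eq_exp_neg_count K w M hM]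
    exact mul_le_of_le_one_right' ((mem_adicCompletionIntegers _ _ _).1 (hy w'))

/-- **The same congruence for the INVERSE `g_f(u)⁻¹`** (the sheet-line junction reads the twist idèle as `z = t(u)^{±1}`; at a prime of `(M)` a unit
`≡ 1` has inverse `≡ 1`: `z⁻¹ − 1 = −z⁻¹(z − 1)`). [cite: NeukirchANT1999, Ch. VI §1 Def. (1.7) p. 363] [cite: Shimura1998, §18.6 proof p. 128] -/
theorem reflexNormFiniteIdele_congr_at_primes_natCast_inv {M : ℕ} (hM : M ≠ 0) {u : (FiniteAdeleRing (𝓞 k) k)ˣ}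
    (hu : ∀ v : HeightOneSpectrum (𝓞 k), Ideal.span {(M : 𝓞 k)} ≤ v.asIdeal →
      Valued.v ((u : FiniteAdeleRing (𝓞 k) k) v) = 1 ∧
      Valued.v ((u : FiniteAdeleRing (𝓞 k) k) v - 1) ≤ exp (-(modulusExp (Ideal.span {(M : 𝓞 k)}) v : ℤ))) :
    ∀ w : HeightOneSpectrum (𝓞 K), Ideal.span {(M : 𝓞 K)} ≤ w.asIdeal →
      Valued.v ((((reflexNormFiniteIdele K Φ k u)⁻¹ : (FiniteAdeleRing (𝓞 K) K)ˣ) : FiniteAdeleRing (𝓞 K) K) w) = 1 ∧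
      Valued.v ((((reflexNormFiniteIdele K Φ k u)⁻¹ : (FiniteAdeleRing (𝓞 K) K)ˣ) : FiniteAdeleRing (𝓞 K) K) w - 1) ≤
        exp (-(modulusExp (Ideal.span {(M : 𝓞 K)}) w : ℤ)) := by
  intro w hw
  obtain ⟨h1, h2⟩ := reflexNormFiniteIdele_congr_at_primes_natCast K Φ k hM hu w hw
  set g : (FiniteAdeleRing (𝓞 K) K)ˣ := reflexNormFiniteIdele K Φ k u with hg
  have hmul : ((g⁻¹ : (FiniteAdeleRing (𝓞 K) K)ˣ) : FiniteAdeleRing (𝓞 K) K) w * (g : FiniteAdeleRing (𝓞 K) K) w = 1 := by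
    rw [mul_comm]
    exact Literature.NumberTheory.Automorphic.FiniteAdeleRing.val_apply_mul_inv_apply g w
  have hinv1 : Valued.v (((g⁻¹ : (FiniteAdeleRing (𝓞 K) K)ˣ) : FiniteAdeleRing (𝓞 K) K) w) = 1 := by
    have h := congrArg Valued.v hmul
    rw [map_mul, h1, mul_one, map_one] at h
    exact h
  refine ⟨hinv1, ?_⟩
  have e : ((g⁻¹ : (FiniteAdeleRing (𝓞 K) K)ˣ) : FiniteAdeleRing (𝓞 K) K) w - 1 =
      -(((g⁻¹ : (FiniteAdeleRing (𝓞 K) K)ˣ) : FiniteAdeleRing (𝓞 K) K) w * ((g : FiniteAdeleRing (𝓞 K) K) w - 1)) := by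
    rw [mul_sub, hmul, mul_one, neg_sub]
  rw [e, Valuation.map_neg, Valuation.map_mul, hinv1, one_mul]
  exact h2

end CongruenceAtPrimes

end Literature.NumberTheory.ComplexMultiplication

end
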